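import Summits.Ventures.CertifiedQuantumChemistry.Rows.V2RDMDualKernelSliced
import HarnessLib

/-!
# Ventures/CertifiedQuantumChemistry — Certificates/HubbardRingL10U100MomentLiterals2.lean: objective merge-stage LITERALS (part 2/2) of `hubbardRingL10U100T` for its kernel v2RDM certificates

HONEST FRAMING (verbatim): certified bounds for a stated model Hamiltonian in a stated basis; not a
claim about the real molecule beyond that model.

OFFERED FILE (pub-qchem-rdm = rdm-A, generation 71, 2026-08-26; ZERO compute: no kit job, no solver run — the cell's
certificate of record was converted OFFLINE in exact rational arithmetic by stdlib Python (folder `work/ksdp/`, the converter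
first re-derived byte-for-byte the landed N₂ literals of `Certificates/N2Sto6gRe*Kernel*.lean`), and every number below is
re-derived or checked by the kernel). The typer owns `Summits/…` and decides whether and where it lands.
CHECK EVIDENCE: {CHECK_EVIDENCE}

WHAT THIS FILE IS. Data only: the first merge STAGE of the objective polynomial of `hubbardRingL10U100T` (`Hamiltonians/HubbardRingL10U100Tables.lean`): the run merges
(`V2RDMDual.mergeRuns`) of the chunk residuals p ∈ 0–4 and p ∈ 5–9 (group sizes [5, 5]), as packed literals — literal part 2 of 2,
behind `hubbardRingL10U100T_objStage` (`Certificates/HubbardRingL10U100MomentObjective.lean`, which CHECKS each against the chunk literals by one `decide +kernel` per group,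
and their merge against `hubbardRingL10U100TObjPoly`). A wrong literal here cannot prove anything: its only use is those kernel equations.
-/

namespace Summit.Ventures.CertifiedQuantumChemistry.Certificates

/-- Run merges of the objective chunk residual groups 0–4, 5–9 of `hubbardRingL10U100T` (17, 17 monomials), packed; literal part 2/2 (behind `hubbardRingL10U100T_objStage`). -/
def hubbardRingL10U100T_objStageL1 : List (List V2RDMDual.Term) := [
  (V2RDMDual.Pack.terms 256 128 1 17 77888632127189544633456144870989354663806 19043063059729006646014107951549908394297841507545331631588736974619815327732583753824610300243056537203228229541227368900722816),
  (V2RDMDual.Pack.terms 256 128 1 17 77888632127189235148446323806296094965631 25919723802508808972829283171145197329705923614534171677456143481225667294767697635525117147787836553058765140219331320913855616)]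

end Summit.Ventures.CertifiedQuantumChemistry.Certificates
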